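/-
COR-CM (cell pub-hodgecm2, stage 2 of the Hodge ladder) — count-neutral KERNEL COMBINATORICS «the dihedral law», part V: THE DATUM IS INHABITED BY
MATHLIBʼS DIHEDRAL GROUP and the law for `DihedralGroup (2n)` (seat prover-pub-hodgecm2-b23-g48-0, binder prover b23, gen 48; claim «DIHEDRAL LAW»,
HOME/INBOX.md l.22267).  Theorems only (no definition: the datum is an existence statement), on part IV (`Census/DihedralLaw.lean`) and Mathlibʼs
`DihedralGroup` BY NAME; no `decide`, no certificate, no named fact, no `sorry`; `Interfaces.lean` (C1), every E term, B01, `Transposition/*`,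
`PortJoin/*`, `D2Bridge/*` untouched.
HONEST FRAMING: `HC_CM` is NOT proved, here or anywhere in the tree; nothing here is a period, a count of record or a headline.
T5: n/a-class — this file IS the consistency check of parts Ia–IV: the hypothesis structure `Dihedral.Datum` is inhabited (`nonempty_datum`).
-/
import Summits.HodgeConjecture.CorCM.Census.DihedralLaw

/-!
# The dihedral law, V: the datum on `DihedralGroup (2n)`; `μ(D_{2n}, rⁿ) = β − 2 = φ₂`

For `n ≥ 1` the dihedral group `DihedralGroup (2 * n)` of order `4n` (Mathlib: rotations `r i`, reflections `sr i`, `i : ℤ/2n`) with the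
central rotation `c = r n` carries the dihedral datum of part Ia: `g = r 1` (order `2n`, `gⁿ = r n`), `s = sr 0`, the rotations `⟨r 1⟩` of index
two, every reflection an involution (`nonempty_datum`).  Hence (part IV BY NAME):

**`isLeast_card_gfaces_generate_dihedralGroup`**: the least number of rank-four face relations whose base changes generate the integer Hodge
lattice of `(DihedralGroup (2n), r n)` modulo pairs is EXACTLY `β − 2 = φ₂` — for every `n ≥ 1` (`D₈`: `22`, `D₁₂`: `202`, `D₁₆`: `2174`, …).
Census dictionary: Galois CM fields with dihedral Galois group of order `4n` and complex conjugation the central rotation (any iso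
`Gal ≃* DihedralGroup (2n)` carrying conjugation to `r n` transports the datum).  Nothing here is a period.

## References
* [Pohlmann1968] H. Pohlmann, Algebraic cycles on abelian varieties of complex multiplication type, Ann. of Math. 88 (1968), Thm 1.
* [Milne1999] J. S. Milne, Lefschetz motives and the Tate conjecture, Compositio Math. 117 (1999), Prop. 2.1, p. 54.
-/

namespace Summit.HodgeConjecture.CorCM.Census.Dihedral

open Finset DihedralGroup
open Summit.HodgeConjecture.CorCM.Prior.AllgGroup.RfwfAllgGroup
open Summit.HodgeConjecture.CorCM.Census.BlockParity
open Summit.HodgeConjecture.CorCM.Census.Coinvariant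

noncomputable section

variable {n : ℕ} [NeZero n]

/-- Every rotation `r i` is a power of `r 1`. [folklore] -/
theorem r_mem_zpowers (i : ZMod (2 * n)) : (r i : DihedralGroup (2 * n)) ∈ Subgroup.zpowers (r 1) := by
  have h : (r 1 : DihedralGroup (2 * n)) ^ i.val = r i := by rw [r_one_pow, ZMod.natCast_zmod_val]
  rw [← h]
  exact Subgroup.pow_mem _ (Subgroup.mem_zpowers _) _

omit [NeZero n] in
/-- No reflection `sr i` is a power of `r 1`. [folklore] -/
theorem sr_notMem_zpowers (i : ZMod (2 * n)) : (sr i : DihedralGroup (2 * n)) ∉ Subgroup.zpowers (r 1) := by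
  intro h
  obtain ⟨k, hk⟩ := Subgroup.mem_zpowers_iff.mp h
  rw [r_one_zpow] at hk
  cases hk

/-- The rotation subgroup `⟨r 1⟩` has index two. [folklore] -/
theorem index_zpowers_r_one : (Subgroup.zpowers (r 1 : DihedralGroup (2 * n))).index = 2 := by
  have h := (Subgroup.zpowers (r 1 : DihedralGroup (2 * n))).card_mul_index
  rw [Nat.card_zpowers, orderOf_r_one, nat_card] at h
  have hn : 0 < 2 * n := by have := NeZero.ne n; omega
  have e : 2 * n * (Subgroup.zpowers (r 1 : DihedralGroup (2 * n))).index = 2 * n * 2 := by rw [h]; ring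
  exact Nat.eq_of_mul_eq_mul_left hn e

/-- **THE DIHEDRAL DATUM IS INHABITED**: `DihedralGroup (2n)` with `c = r n`, `g = r 1`, `s = sr 0`. [folklore] -/
theorem nonempty_datum : Nonempty (Datum (DihedralGroup (2 * n)) (r (n : ZMod (2 * n))) n) :=
  ⟨{ g := r 1
     s := sr 0
     hgn := r_one_pow n
     hord := orderOf_r_one
     hindex := index_zpowers_r_one
     hs := sr_notMem_zpowers 0
     hinvol := fun x hx => by
       cases x with
       | r i => exact absurd (r_mem_zpowers i) hx
       | sr i => exact sr_mul_self i }⟩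

omit [NeZero n] in
/-- `c = r n` is an involution of `DihedralGroup (2n)`. [folklore] -/
theorem r_n_mul_r_n : (r (n : ZMod (2 * n)) : DihedralGroup (2 * n)) * r (n : ZMod (2 * n)) = 1 := by
  rw [r_mul_r, ← Nat.cast_add, ← two_mul, ZMod.natCast_self, ← one_def]

/-- `c = r n ≠ 1` in `DihedralGroup (2n)`. [folklore] -/
theorem r_n_ne_one : (r (n : ZMod (2 * n)) : DihedralGroup (2 * n)) ≠ 1 := by
  rw [one_def]
  intro h
  have h' : (n : ZMod (2 * n)) = 0 := by injection h
  exact QuaternionColumn.natCast_n_ne_zero h'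

/-- **THE DIHEDRAL LAW FOR `DihedralGroup (2n)`, `c = r n`**: the least number of rank-four face relations whose base changes generate the integer
Hodge lattice modulo pairs is EXACTLY `β − 2`. [folklore] -/
theorem isLeast_card_gfaces_generate_dihedralGroup (hc2 : (r (n : ZMod (2 * n)) : DihedralGroup (2 * n)) * r (n : ZMod (2 * n)) = 1) :
    IsLeast {m : ℕ | ∃ S : Finset (CMF (DihedralGroup (2 * n)) (r (n : ZMod (2 * n))) →₀ ℤ),
      ↑S ⊆ gfaceSet (DihedralGroup (2 * n)) (r (n : ZMod (2 * n))) hc2 ∧ S.card = m ∧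
      hodgeSpan (r (n : ZMod (2 * n))) hc2 ≤ Submodule.span ℤ (pairSet (r (n : ZMod (2 * n)))) ⊔
        Submodule.span ℤ (translates (r (n : ZMod (2 * n))) S)}
      (Fintype.card (Block (r (n : ZMod (2 * n)) : DihedralGroup (2 * n))) - 2) :=
  isLeast_card_gfaces_generate (Classical.choice nonempty_datum) hc2 r_n_ne_one

/-- **… and EXACTLY `φ₂`** (`β = φ₂ + 2`). [folklore] -/
theorem isLeast_card_gfaces_generate_dihedralGroup_fibreTwo
    (hc2 : (r (n : ZMod (2 * n)) : DihedralGroup (2 * n)) * r (n : ZMod (2 * n)) = 1) :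
    IsLeast {m : ℕ | ∃ S : Finset (CMF (DihedralGroup (2 * n)) (r (n : ZMod (2 * n))) →₀ ℤ),
      ↑S ⊆ gfaceSet (DihedralGroup (2 * n)) (r (n : ZMod (2 * n))) hc2 ∧ S.card = m ∧
      hodgeSpan (r (n : ZMod (2 * n))) hc2 ≤ Submodule.span ℤ (pairSet (r (n : ZMod (2 * n)))) ⊔
        Submodule.span ℤ (translates (r (n : ZMod (2 * n))) S)}
      (fibreTwo (r (n : ZMod (2 * n)) : DihedralGroup (2 * n)) hc2) :=
  isLeast_card_gfaces_generate_fibreTwo (Classical.choice nonempty_datum) hc2 r_n_ne_one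

/-- `β(DihedralGroup (2n), r n) = φ₂ + 2`. [folklore] -/
theorem card_block_dihedralGroup (hc2 : (r (n : ZMod (2 * n)) : DihedralGroup (2 * n)) * r (n : ZMod (2 * n)) = 1) :
    Fintype.card (Block (r (n : ZMod (2 * n)) : DihedralGroup (2 * n))) = fibreTwo (r (n : ZMod (2 * n)) : DihedralGroup (2 * n)) hc2 + 2 :=
  card_block_eq_fibreTwo_add_two (Classical.choice nonempty_datum) hc2 r_n_ne_one

end

end Summit.HodgeConjecture.CorCM.Census.Dihedral
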